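import Summits.HubbardSuperconductivity.HubbardSuperconductivity.Theorems.AnisotropyChordTransferFibre3FinXCCover

/-!
# Route `AnisotropyChord` / H0 rotor rung: FIN combined (rows `N₁` + C) certificate at `L = 9` — cell facts, part `f`

Kernel facts `xbcCellAny 9 (49/50) 20 la lb (c, bn) = true` (`decide +kernel`, zero data) for 8 λ-cells of the per-`L` cover
(`…FinXCCover.xbcCheck`; cell design: p3 g5 scratch `xbc_design.py`, mirrors `xb_mirror.py`/`xc_mirror.py`); assembled in `…FinXBCNine`.
Prover seat `hubbard-h0-rotor-p3` g5; helper for piece A = stmt-HubbardSuperconductivity-23918 of rung 19089 (`--supports`, helper class).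
WHAT THIS IS NOT: nothing here proves superconductivity in the Hubbard model (rotor TARGET as worded stays FALSE, g15 verdict); kernel facts for the FIN certificate of two hypotheses (rows `N₁`, C) of ONE conditional reduction.  Tree imports only; no sorry, no new axioms.
-/

set_option linter.dupNamespace false

namespace Summit.HubbardSuperconductivity.HubbardSuperconductivity.Theorems.AnisotropyChord.Transfer.Fibre3

namespace FinXB

set_option maxHeartbeats 4000000 in
/-- kernel fact: cell 52 at `L = 9` (certified, c = (2/5 : ℚ), b = 13/20). [folklore] -/
theorem xbc9_52 : xbcCellAny 9 (49/50 : ℚ) 20 2505741144461897 2568384673073445 ((2/5 : ℚ), (13 : ℕ)) = true := by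
  decide +kernel

set_option maxHeartbeats 4000000 in
/-- kernel fact: cell 53 at `L = 9` (certified, c = (2/5 : ℚ), b = 13/20). [folklore] -/
theorem xbc9_53 : xbcCellAny 9 (49/50 : ℚ) 20 2568384673073445 2632594289900282 ((2/5 : ℚ), (13 : ℕ)) = true := by
  decide +kernel

set_option maxHeartbeats 4000000 in
/-- kernel fact: cell 54 at `L = 9` (certified, c = (2/5 : ℚ), b = 13/20). [folklore] -/
theorem xbc9_54 : xbcCellAny 9 (49/50 : ℚ) 20 2632594289900282 2698409147147790 ((2/5 : ℚ), (13 : ℕ)) = true := by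
  decide +kernel

set_option maxHeartbeats 4000000 in
/-- kernel fact: cell 55 at `L = 9` (certified, c = (2/5 : ℚ), b = 13/20). [folklore] -/
theorem xbc9_55 : xbcCellAny 9 (49/50 : ℚ) 20 2698409147147790 2765869375826485 ((2/5 : ℚ), (13 : ℕ)) = true := by
  decide +kernel

set_option maxHeartbeats 4000000 in
/-- kernel fact: cell 56 at `L = 9` (certified, c = (2/5 : ℚ), b = 13/20). [folklore] -/
theorem xbc9_56 : xbcCellAny 9 (49/50 : ℚ) 20 2765869375826485 2835016110222148 ((2/5 : ℚ), (13 : ℕ)) = true := by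
  decide +kernel

set_option maxHeartbeats 4000000 in
/-- kernel fact: cell 57 at `L = 9` (certified, c = (2/5 : ℚ), b = 13/20). [folklore] -/
theorem xbc9_57 : xbcCellAny 9 (49/50 : ℚ) 20 2835016110222148 2905891512977702 ((2/5 : ℚ), (13 : ℕ)) = true := by
  decide +kernel

set_option maxHeartbeats 4000000 in
/-- kernel fact: cell 58 at `L = 9` (certified, c = (2/5 : ℚ), b = 13/20). [folklore] -/
theorem xbc9_58 : xbcCellAny 9 (49/50 : ℚ) 20 2905891512977702 2978538800802145 ((2/5 : ℚ), (13 : ℕ)) = true := by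
  decide +kernel

set_option maxHeartbeats 4000000 in
/-- kernel fact: cell 59 at `L = 9` (certified, c = (2/5 : ℚ), b = 13/20). [folklore] -/
theorem xbc9_59 : xbcCellAny 9 (49/50 : ℚ) 20 2978538800802145 3053002270822199 ((2/5 : ℚ), (13 : ℕ)) = true := by
  decide +kernel

end FinXB

end Summit.HubbardSuperconductivity.HubbardSuperconductivity.Theorems.AnisotropyChord.Transfer.Fibre3
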